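import Mathlib
import Summits.Ventures.PercRepro2.K5Digits
import Summits.Ventures.PercRepro2.PMK5Deg2KernelA1A2
import Summits.Ventures.PercRepro2.Deg2A1A2Kron

/-!
# The digit bridge of the twelve-edge certificate (blind cell PercRepro2, mine-2 g26; typer-1's
`K5Digits.lean` / `K5TypedK3.le_of_kron_le'` with `KB = 2^24`, mask bit `23`, `4^12` digits)

* `mask_eq`, `mask_digit`, `mask_testBit`: the mask of `PMK5Deg2KernelA1A2.lean` is `Σ_{j < 4^12} 2^23 · KB^j`,
  every digit `2^23`, bit `24 j + 23` set;
* `digit_lt_of_land_mask`: `Nat.land X mask = 0` forces every base-`KB` digit of `X` below `2^23`;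
* `sum_profiles_eq`: a sum over the profiles `Fin 12 → Fin 4` re-indexed over `range (4^12)` by `decode4`;
* **`le_of_kron_le'`**: if `P = Σ_k a k KB^{idx4 k}`, `M = Σ_k b k KB^{idx4 k}` with `a, b < KB`, `M ≤ P`,
  `Nat.land (P − M) mask = 0` and `Nat.land M mask = 0`, then `b k ≤ a k` for every profile `k` — the three
  conditions of the certificate read digit by digit (the generic digit lemmas `K5.digit_sum`,
  `K5.sum_lt_pow`, `K5.expand_digits` are base-independent and reused).
-/

namespace Summit.Ventures.PercRepro2

namespace Deg2A1A2

/-! ## The mask reads bit `23` of every digit -/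

section Mask

/-- `KB = 2^24`. -/
lemma KB_eq : KB = 2 ^ 24 := rfl

/-- `KB^j = 2^(24 j)`. -/
lemma KB_pow (j : ℕ) : KB ^ j = 2 ^ (24 * j) := by
  rw [KB_eq, ← pow_mul]

/-- The scaled geometric sum, for any length `m`. -/
lemma scaled_geomSum (m : ℕ) :
    2 ^ 23 * ((KB ^ m - 1) / (KB - 1)) = ∑ j ∈ Finset.range m, 2 ^ 23 * KB ^ j := by
  rw [← Nat.geomSum_eq (by rw [KB_eq]; norm_num) m]
  exact Finset.mul_sum _ _ _

/-- The mask is `Σ_{j < 4^12} 2^23 · KB^j`. -/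
lemma mask_eq : mask = ∑ j ∈ Finset.range (4 ^ 12), 2 ^ 23 * KB ^ j := scaled_geomSum (4 ^ 12)

/-- Every base-`KB` digit of the mask is `2^23`. -/
lemma mask_digit {j : ℕ} (hj : j < 4 ^ 12) : mask / KB ^ j % KB = 2 ^ 23 := by
  rw [mask_eq]
  exact K5.digit_sum (B := KB) (by rw [KB_eq]; norm_num) (fun _ => 2 ^ 23) (4 ^ 12)
    (fun _ _ => by rw [KB_eq]; norm_num) j hj

/-- Bit `23` of the base-`KB` digit `j` of `X` is the bit `24 j + 23` of `X`. -/
lemma testBit_digit (X j : ℕ) :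
    X.testBit (24 * j + 23) = decide ((X / KB ^ j % KB) / 2 ^ 23 = 1) := by
  rw [Nat.testBit_eq_decide_div_mod_eq, KB_pow, KB_eq]
  congr 1
  have h1 : X / 2 ^ (24 * j + 23) = X / 2 ^ (24 * j) / 2 ^ 23 := by
    rw [Nat.div_div_eq_div_mul, ← pow_add]
  have h2 : X / 2 ^ (24 * j) % 2 ^ 24 / 2 ^ 23 = X / 2 ^ (24 * j) / 2 ^ 23 % 2 := by
    rw [show (2 : ℕ) ^ 24 = 2 ^ 23 * 2 from by norm_num, Nat.mod_mul_right_div_self]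
  rw [h1, h2]

/-- Bit `24 j + 23` of the mask is set for `j < 4^12`. -/
lemma mask_testBit {j : ℕ} (hj : j < 4 ^ 12) : mask.testBit (24 * j + 23) = true := by
  rw [testBit_digit, mask_digit hj, Nat.div_self (by norm_num), decide_eq_true_iff]

/-- **The mask test bounds the digits**: `Nat.land X mask = 0` forces every base-`KB` digit of `X` below
`2^23`. -/
theorem digit_lt_of_land_mask {X : ℕ} (h : Nat.land X mask = 0) {j : ℕ} (hj : j < 4 ^ 12) :
    X / KB ^ j % KB < 2 ^ 23 := by
  have hbit : X.testBit (24 * j + 23) = false := by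
    change X &&& mask = 0 at h
    have := congrArg (fun n => n.testBit (24 * j + 23)) h
    simp only [Nat.testBit_land, Nat.zero_testBit] at this
    rwa [mask_testBit hj, Bool.and_true] at this
  rw [testBit_digit, decide_eq_false_iff_not] at hbit
  have hlt : X / KB ^ j % KB < KB := Nat.mod_lt _ (by rw [KB_eq]; norm_num)
  rw [KB_eq] at hlt
  have hq : X / KB ^ j % KB / 2 ^ 23 < 2 := by
    rw [Nat.div_lt_iff_lt_mul (by norm_num)]
    calc X / KB ^ j % KB < 2 ^ 24 := hlt
      _ = 2 * 2 ^ 23 := by norm_num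
  have hq0 : X / KB ^ j % KB / 2 ^ 23 = 0 := by omega
  rwa [Nat.div_eq_zero_iff_lt (by norm_num)] at hq0

end Mask

/-! ## Profiles as digits -/

section Profiles

/-- `4^12 = 16777216`. -/
lemma four_pow_twelve : (4 : ℕ) ^ 12 = 16777216 := by norm_num

/-- A sum over the profiles re-indexed over `range (4^12)` through `decode4`. -/
lemma sum_profiles_eq (c : (Fin 12 → Fin 4) → ℕ) :
    ∑ k, c k * KB ^ idx4 k = ∑ j ∈ Finset.range (4 ^ 12), c (decode4 j) * KB ^ j := by
  refine Finset.sum_nbij' idx4 decode4 (fun k _ => ?_) (fun j _ => Finset.mem_univ _)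
    (fun k _ => decode4_idx4 k) (fun j hj => ?_) (fun k _ => ?_)
  · exact Finset.mem_range.2 (by rw [four_pow_twelve]; exact idx4_lt k)
  · exact idx4_decode4 (by have h := Finset.mem_range.1 hj; rwa [four_pow_twelve] at h)
  · rw [decode4_idx4]

/-- **The digit argument with the third mask test**: if `P = Σ_k a k KB^{idx4 k}`,
`M = Σ_k b k KB^{idx4 k}` with `a, b < KB`, `M ≤ P`, `Nat.land (P − M) mask = 0` and
`Nat.land M mask = 0`, then `b k ≤ a k` for every profile `k` (the digits of `M` are the `b k`, hence
`< 2^23` by the mask; the digits of `P − M` are `< 2^23` by the mask; so `P = (P − M) + M` digit by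
digit without carry). -/
theorem le_of_kron_le' (a b : (Fin 12 → Fin 4) → ℕ) (ha : ∀ k, a k < KB) (hb : ∀ k, b k < KB)
    {P M : ℕ} (hP : P = ∑ k, a k * KB ^ idx4 k) (hM : M = ∑ k, b k * KB ^ idx4 k) (hle : M ≤ P)
    (hmask : Nat.land (P - M) mask = 0) (hmaskM : Nat.land M mask = 0) (k : Fin 12 → Fin 4) :
    b k ≤ a k := by
  have hKB : 2 ≤ KB := by rw [KB_eq]; norm_num
  -- the digits of `M` are the `b`'s, hence below `2^23`
  have hb' : ∀ k, b k < 2 ^ 23 := by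
    intro k
    have hj : idx4 k < 4 ^ 12 := by rw [four_pow_twelve]; exact idx4_lt k
    have h1 : M / KB ^ idx4 k % KB = b k := by
      rw [hM, sum_profiles_eq]
      rw [K5.digit_sum hKB (fun j => b (decode4 j)) (4 ^ 12) (fun j _ => hb _) (idx4 k) hj,
        decode4_idx4]
    rw [← h1]
    exact digit_lt_of_land_mask hmaskM hj
  set D := P - M with hD
  have hDM : P = D + M := by omega
  have hdlt : ∀ j < 4 ^ 12, D / KB ^ j % KB < 2 ^ 23 := fun j hj => digit_lt_of_land_mask hmask hj
  have hPlt : P < KB ^ (4 ^ 12) := by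
    rw [hP, sum_profiles_eq]
    exact K5.sum_lt_pow hKB _ _ fun j _ => ha _
  have hDlt : D < KB ^ (4 ^ 12) := by omega
  have hDsum := K5.expand_digits hKB (4 ^ 12) D hDlt
  have hPsum : P = ∑ j ∈ Finset.range (4 ^ 12), (D / KB ^ j % KB + b (decode4 j)) * KB ^ j := by
    rw [hDM, hM, sum_profiles_eq]
    conv_lhs => rw [hDsum]
    rw [← Finset.sum_add_distrib]
    exact Finset.sum_congr rfl fun j _ => by ring
  have hj : idx4 k < 4 ^ 12 := by rw [four_pow_twelve]; exact idx4_lt k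
  have h1 : P / KB ^ idx4 k % KB = a k := by
    rw [hP, sum_profiles_eq]
    rw [K5.digit_sum hKB (fun j => a (decode4 j)) (4 ^ 12) (fun j _ => ha _) (idx4 k) hj,
      decode4_idx4]
  have h2 : P / KB ^ idx4 k % KB = D / KB ^ idx4 k % KB + b k := by
    rw [hPsum]
    rw [K5.digit_sum hKB (fun j => D / KB ^ j % KB + b (decode4 j)) (4 ^ 12)
      (fun j hj' => by
        have := hdlt j hj'; have := hb' (decode4 j)
        have h2 : (2 : ℕ) ^ 23 + 2 ^ 23 = KB := by rw [KB_eq]; norm_num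
        omega) (idx4 k) hj,
      decode4_idx4]
  have e : a k = D / KB ^ idx4 k % KB + b k := h1.symm.trans h2
  rw [e]
  exact Nat.le_add_left _ _

end Profiles

end Deg2A1A2

end Summit.Ventures.PercRepro2
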